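/-
HONEST FRAMING: certified error envelopes and provably optimal rounding/accumulation schemes for
low-precision formats under stated cost models; every table by two implementations; no hardware
or vendor claims.
-/
import Summits.Ventures.CertifiedArithmetic.LowPrec.OptDemotionBudgetTable

/-!
# The demotion law (Theorem T8), part 7b: `Φ*` is NONDECREASING along the grid

`phiVal_mono`: for mantissas `n, n' ∈ [2^(q-1), 2^q)` and depths `k, k'` with `n/2^k ≤ n'/2^k'`,
`Φ*_s(n/2^k) ≤ Φ*_s(n'/2^k')` for every shape `s` — the property that makes the evaluator of part
7a′ (right child := the largest admissible grid value `bmax`) the exact relaxation and that drives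
the soundness proof of part 7b′.  Node case (`nodeEntry_mono`): every admissible left candidate of
the smaller budget is dominated by a candidate of the larger budget — the same grid value or, when
it would be deeper than `q+1`, its lift to depth `q+1` (which only enlarges `Φ*_a` and frees the whole
budget for the right child) — using `bmax_spec` and the induction hypothesis of the right subtree.
-/

namespace Summit.Ventures.CertifiedArithmetic.LowPrec.Opt

open Literature.ComputerArithmetic.JeannerodRump2018
open Literature.ComputerArithmetic.JeannerodRump2018.SumTree

/-! ## Monotonicity of `Φ*` (part 7b, §1)

`Φ*` is nondecreasing along the grid: `n/2^k ≤ n'/2^k' ⟹ phiVal s n k ≤ phiVal s n' k'`.  The node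
case dominates every admissible left candidate of the smaller budget by a candidate of the larger one
(the same grid value, or — if it would be deeper than `q+1` — its lift to depth `q+1`, which only
enlarges the value and frees the whole budget for the right child), using the maximality of `bmax`
and the induction hypothesis for the right subtree. -/

/-- `bmax` on a small left value returns the budget itself. -/
theorem bmax_small {q m A : ℕ} (h : A ≤ 2 ^ q) : bmax q m A = (m, 0) := by
  unfold bmax; exact if_pos h

/-- Admissibility of a candidate in rational form. -/
theorem candOK_iff_rat {q m : ℕ} {c : ℕ × ℕ} (hc2 : c.2 ≤ q + 1) :
    candOK q m c = true ↔ (c.1 : ℚ) / 2 ^ c.2 ≤ m := by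
  rw [candOK_iff]
  obtain ⟨d, hd⟩ : ∃ d, q + 1 = c.2 + d := ⟨q + 1 - c.2, by omega⟩
  have hdsub : q + 1 - c.2 = d := by omega
  rw [hdsub, div_le_iff₀ (by positivity)]
  constructor
  · intro h
    have h' : ((c.1 * 2 ^ d : ℕ) : ℚ) ≤ ((m * 2 ^ (q + 1) : ℕ) : ℚ) := by exact_mod_cast h
    push_cast at h'
    rw [hd, pow_add] at h'
    have hp : (0 : ℚ) < 2 ^ d := by positivity
    nlinarith
  · intro h
    have h' : (c.1 : ℚ) * 2 ^ d ≤ (m : ℚ) * 2 ^ (q + 1) := by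
      rw [hd, pow_add]
      have hp : (0 : ℚ) < 2 ^ d := by positivity
      nlinarith
    exact_mod_cast h'

/-- Depth shift of `phiVal`: `phiVal s n k = 2^j · phiVal s n (k + j)`. -/
theorem phiVal_shift (q : ℕ) (s : Shape) (n k j : ℕ) :
    phiVal q s n k = 2 ^ j * phiVal q s n (k + j) := by
  unfold phiVal; rw [pow_add]; field_simp

/-- The candidate term read through the children's tables. -/
theorem candTerm_eq (q : ℕ) (a b : Shape) (m : ℕ) (c : ℕ × ℕ) :
    candTerm q (phiTab q a) (phiTab q b) m c =
      phiVal q a c.1 c.2 +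
      phiVal q b (bmax q m (c.1 * 2 ^ (q + 1 - c.2))).1 (bmax q m (c.1 * 2 ^ (q + 1 - c.2))).2 := by
  simp only [candTerm, gval_phiTab]

/-- THE NODE CASE OF MONOTONICITY: if `Φ*_b` is monotone along the grid then
`nodeEntry(n) / 2^j ≤ nodeEntry(n')` whenever `n / 2^j ≤ n'`. -/
theorem nodeEntry_mono {q : ℕ} (hq : 1 ≤ q) (a b : Shape)
    (ihb : ∀ {n k n' k' : ℕ}, 2 ^ (q - 1) ≤ n → n < 2 ^ q → 2 ^ (q - 1) ≤ n' → n' < 2 ^ q →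
      (n : ℚ) / 2 ^ k ≤ (n' : ℚ) / 2 ^ k' → phiVal q b n k ≤ phiVal q b n' k')
    {n n' j : ℕ} (hn : 2 ^ (q - 1) ≤ n) (hn' : n < 2 ^ q) (hN : 2 ^ (q - 1) ≤ n') (hN' : n' < 2 ^ q)
    (h : (n : ℚ) / 2 ^ j ≤ n') :
    nodeEntry q (phiTab q a) (phiTab q b) n / 2 ^ j ≤ nodeEntry q (phiTab q a) (phiTab q b) n' := by
  have h2j : (0 : ℚ) < 2 ^ j := by positivity
  have hhalf : (1 : ℚ) / 2 ^ (j + 1) ≤ 1 / 2 :=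
    div_le_div_of_nonneg_left (by norm_num) (by norm_num) (by
      rw [pow_succ]; have : (1 : ℚ) ≤ 2 ^ j := one_le_pow₀ (by norm_num); linarith)
  rw [div_le_iff₀ h2j]
  unfold nodeEntry
  apply candMax_le
  · -- the a = 0 term: phiVal b n 0 ≤ 2^j phiVal b n' 0 ≤ 2^j nodeEntry n'
    rw [gval_phiTab, phiVal_shift q b n 0 j, zero_add, mul_comm]
    refine mul_le_mul_of_nonneg_right ?_ h2j.le
    refine le_trans (ihb (k := j) (k' := 0) hn hn' hN hN' (by simpa using h)) ?_
    rw [← gval_phiTab]; exact init_le_candMax q _ _ n' _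
  · intro c hc hok
    obtain ⟨hma, hma', hja⟩ := cands_bounds hq hc
    have hle : (c.1 : ℚ) / 2 ^ c.2 ≤ n := (candOK_iff_rat hja).mp hok
    obtain ⟨hmb, hmb', hbm, hbsum, -⟩ := bmax_spec hq hn hn' hma' hja hle
    set mb := (bmax q n (c.1 * 2 ^ (q + 1 - c.2))).1 with hmbdef
    set jb := (bmax q n (c.1 * 2 ^ (q + 1 - c.2))).2 with hjbdef
    have hsplit : candTerm q (phiTab q a) (phiTab q b) n c
        = (phiVal q a c.1 (c.2 + j) + phiVal q b mb (jb + j)) * 2 ^ j := by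
      rw [candTerm_eq, ← hmbdef, ← hjbdef, phiVal_shift q a c.1 c.2 j, phiVal_shift q b mb jb j]; ring
    rw [hsplit]
    refine mul_le_mul_of_nonneg_right ?_ h2j.le
    -- facts about the shifted pair at budget n'
    have hbm' : (mb : ℚ) / 2 ^ (jb + j) ≤ n' := by
      rw [pow_add, ← div_div]
      exact le_trans (div_le_div_of_nonneg_right hbm h2j.le) h
    have hsum' : (mb : ℚ) / 2 ^ (jb + j) + (c.1 : ℚ) / 2 ^ (c.2 + j) ≤ n' + 1 / 2 := by
      rw [pow_add, pow_add, ← div_div, ← div_div, ← add_div]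
      have h1 : ((mb : ℚ) / 2 ^ jb + (c.1 : ℚ) / 2 ^ c.2) / 2 ^ j ≤ ((n : ℚ) + 1 / 2) / 2 ^ j :=
        div_le_div_of_nonneg_right hbsum h2j.le
      have h3 : ((n : ℚ) + 1 / 2) / 2 ^ j = (n : ℚ) / 2 ^ j + 1 / 2 ^ (j + 1) := by
        rw [pow_succ]; field_simp
      linarith
    by_cases hD : c.2 + j ≤ q + 1
    · -- the same grid value is a candidate of n'
      have hmem : (c.1, c.2 + j) ∈ cands q := mem_cands hma hma' hD hq
      have hok' : candOK q n' (c.1, c.2 + j) = true := by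
        rw [candOK_iff_rat (by exact hD)]
        simp only
        rw [pow_add, ← div_div]
        exact le_trans (div_le_div_of_nonneg_right hle h2j.le) h
      refine le_trans ?_ (term_le_candMax q _ _ n' _ _ hmem hok')
      rw [candTerm_eq]
      simp only
      refine add_le_add le_rfl ?_
      obtain ⟨hmb2, hmb2', -, -, hmax2⟩ := bmax_spec hq hN hN' hma' hD
        ((candOK_iff_rat (c := (c.1, c.2 + j)) hD).mp hok')
      exact ihb hmb hmb' hmb2 hmb2' (hmax2 mb (jb + j) hmb hmb' hbm' hsum')
    · -- lift the left value to depth q+1; the right child gets the whole budget n'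
      rw [not_le] at hD
      have hmem : (c.1, q + 1) ∈ cands q := mem_cands hma hma' le_rfl hq
      have hsmallA : c.1 * 2 ^ (q + 1 - (q + 1)) ≤ 2 ^ q := by simp; omega
      have hok' : candOK q n' (c.1, q + 1) = true := by
        rw [candOK_iff]
        simp only [Nat.sub_self, pow_zero, mul_one]
        have h1 : 1 ≤ n' := le_trans Nat.one_le_two_pow hN
        calc c.1 ≤ 2 ^ q := hma'.le
          _ ≤ 2 ^ (q + 1) := Nat.pow_le_pow_right (by norm_num) (by omega)
          _ ≤ n' * 2 ^ (q + 1) := Nat.le_mul_of_pos_left _ h1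
      refine le_trans ?_ (term_le_candMax q _ _ n' _ _ hmem hok')
      rw [candTerm_eq]
      simp only
      rw [bmax_small hsmallA]
      simp only
      refine add_le_add (phiVal_depth_antitone q a c.1 hD.le) ?_
      exact ihb (k' := 0) hmb hmb' hN hN' (by simpa using hbm')

/-- **`Φ*` IS NONDECREASING ALONG THE GRID**: `n/2^k ≤ n'/2^k' ⟹ Φ*_s(n/2^k) ≤ Φ*_s(n'/2^k')`
(mantissas in `[2^(q-1), 2^q)`, any depths). -/
theorem phiVal_mono {q : ℕ} (hq : 1 ≤ q) :
    ∀ (s : Shape) {n k n' k' : ℕ}, 2 ^ (q - 1) ≤ n → n < 2 ^ q → 2 ^ (q - 1) ≤ n' → n' < 2 ^ q →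
      (n : ℚ) / 2 ^ k ≤ (n' : ℚ) / 2 ^ k' → phiVal q s n k ≤ phiVal q s n' k'
  | .lf, n, k, n', k', hn, hn', hN, hN', h => by
      unfold phiVal; rw [phi_lf hn hn' hq, phi_lf hN hN' hq]; exact h
  | .nd a b, n, k, n', k', hn, hn', hN, hN', h => by
      have hkk : k' ≤ k := depth_le_of_gridVal_le hn hN' hq h
      obtain ⟨j, rfl⟩ : ∃ j, k = k' + j := ⟨k - k', by omega⟩
      have h' : (n : ℚ) / 2 ^ j ≤ n' := by
        rw [add_comm] at h
        have := (gridVal_le_shift n j n' 0 k').mp (by simpa [add_comm] using h)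
        simpa using this
      unfold phiVal
      rw [phi_nd hn hn' hq, phi_nd hN hN' hq, pow_add, mul_comm, ← div_div]
      exact div_le_div_of_nonneg_right
        (nodeEntry_mono hq a b (fun hn hn' hN hN' h => phiVal_mono hq b hn hn' hN hN' h) hn hn' hN hN' h')
        (by positivity)

end Summit.Ventures.CertifiedArithmetic.LowPrec.Opt
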